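/-
Copyright (c) 2026 the pub-hodgecm-mathlib formalisation cell (harness21).  Prover seat hodgecm-mathlib-LH4-p13 (g6), req620 Track A «(D-RAM) FOUR-FRAME» squad, unit U2H:
the (ρ2b′-X) child `stub_U2H_fixedPointCensus_typeTwo_unit0` (U2H :418) — GLUE between the payer's eigen-package letters (`lam`, `u`, `δ`, `μ = lam − u`) and the primed one-field
letters of ★ p857819 ∕ p857887 ∕ p857901 (`λ′ = lam∕δ`, `u′ = u∕δ`, `κ = ρμ∕μ`, the (D3) unit `z` with `ρz = κ·z`).  2026-09-04.
-/
import Mathlib.Topology.Algebra.Valued.ValuedField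
import Mathlib.RingTheory.Valuation.Basic
import HarnessLib

/-!
# Crux `H413`, line LH4 «(D-RAM) FOUR-FRAME» — unit U2H, (ρ2b′-X): letter glue for the RamK (D3) evaluation — primed letters, `ρz₊ = κ·z₊`, the `m`-token from `|μ·ρμ|`

Cell `hodgecm-mathlib` (D-0151), FLOOR 0, crux item H413 = `stmt-HodgeConjecture-24833`; squad F0∕P3c∕LH4; registered stub served: `F0P3cDyRamFourFrameU2H.stub_U2H_fixedPointCensus_typeTwo_unit0`
((ρ2b′-X), U2H :418) through LH4-p14's HEAD-OF-ORGANS, RK branch of the (C0) census.  THEOREMS ONLY (no `def`, no instance, no notation, no `sorry`); lane `--supports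
stmt-HodgeConjecture-24833` (count-neutral).  Three one-field bookkeeping facts the payer needs to feed ★ p857819 §4 (`hlamΘ hlamρ hu hu1`), ★ p857887 §5 (`hκz : ρz = κ·z`) and
★ p857764 (`hm : |μ| = exp(−m)`) from its own letters:
* §1 `primed_letters`: from `Θlam·lam = 1`, `lam·ρlam = D`, `δ·δ = D`, `Θδ·δ = 1`, `ρδ = δ`, `ρu = u`, `Θu·u = 1`: `λ′ := lam∕δ` has `λ′·Θλ′ = 1 = λ′·ρλ′`, `u′ := u∕δ` has `ρu′ = u′`,
  `u′·Θu′ = 1`, and `lam − u = δ·(λ′ − u′)`.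
* §2 `rho_diagUnit_eq_kappa_mul`: for `z` with `μ·h·(α − ρα) = π·z`, `ρh = −h`, `ρπ = π` (`ρ` involutive), `μ ≠ 0`: `ρz = (ρμ∕μ)·z` — the hypothesis `hκz` of ★ p857887 for the
  hyperbolic line model.
* §3 `v_eq_exp_neg_of_v_mul_map_eq`: `ρ` isometric, `|μ·ρμ| = exp(−2m)` ⇒ `|μ| = exp(−m)` — the socket's `m` (`|χ_{γ₂}(u)|_w = |ϖ_v^m|_w`, `χ(u) = N_{M∕E}(u − λ)`) is the one-field `m`.
* §4 (ED. 2) `exists_thetaFixed_unramified_generator`: socket B's type letters `|α − ρα| = 1`, `|α − Θα| < 1` (wild) give the RK generator `αK := α·Θα` (`Θ`-fixed, integral, `|αK − ραK| = 1`).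
HONEST LABEL.  Count-neutral helper; (ρ2b′-X) OPEN; `HC_CM` is proved only modulo the 7 printed citations (2 remaining named inputs: hLiu418 = `stmt-HodgeConjecture-24832`, h413 =
`stmt-HodgeConjecture-24833`) until rung 0 closes.

## References
* [Rogawski1990] J. D. Rogawski, *Automorphic Representations of Unitary Groups in Three Variables*, Ann. of Math. Stud. 123 (1990), §4.9 p. 55, Lemma 4.9.3 p. 56.
* [Kottwitz1986BaseChangeUnits] R. E. Kottwitz, *Base change for unit elements of Hecke algebras*, Compositio Math. 60 (1986), §1 pp. 240–241.
-/

set_option autoImplicit false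

open WithZero

namespace Summit.HodgeConjecture.HodgeConjecture.Cruxes.H413.F0P3cDyRamTokenFrameGlueRamK

variable {K : Type*} [Field K]

/-! ## §1 Primed letters -/

/-- **PRIMED LETTERS.**  If `Θlam·lam = 1`, `lam·ρlam = D`, `δ·δ = D`, `Θδ·δ = 1`, `ρδ = δ`, `ρu = u`, `Θu·u = 1`, then with `λ′ := lam∕δ`, `u′ := u∕δ`:
`λ′·Θλ′ = 1`, `λ′·ρλ′ = 1`, `ρu′ = u′`, `u′·Θu′ = 1`, and `lam − u = δ·(λ′ − u′)` — the letters `hlamΘ hlamρ hu hu1` of ★ `exists_diagUnit_decomp` and `μ = δμ′`.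
[cite: Rogawski1990, §4.9 Lemma 4.9.3 p. 56] -/
theorem primed_letters {ρ Θ : K →+* K} {lam u δ D : K} (hΘlam : Θ lam * lam = 1) (hlamρ : lam * ρ lam = D) (hδ : δ * δ = D) (hΘδ : Θ δ * δ = 1)
    (hρδ : ρ δ = δ) (hu : ρ u = u) (hΘu : Θ u * u = 1) :
    lam / δ * Θ (lam / δ) = 1 ∧ lam / δ * ρ (lam / δ) = 1 ∧ ρ (u / δ) = u / δ ∧ u / δ * Θ (u / δ) = 1 ∧ lam - u = δ * (lam / δ - u / δ) := by
  have hδ0 : δ ≠ 0 := fun h0 => by rw [h0, mul_zero] at hΘδ; exact zero_ne_one hΘδ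
  have hΘδ0 : Θ δ ≠ 0 := (map_ne_zero Θ).2 hδ0
  refine ⟨?_, ?_, by rw [map_div₀, hu, hρδ], ?_, by field_simp⟩
  · rw [map_div₀, div_mul_div_comm, mul_comm lam, hΘlam, mul_comm δ, hΘδ, div_one]
  · rw [map_div₀, hρδ, div_mul_div_comm, hlamρ, hδ, div_self (by rw [← hδ]; exact mul_ne_zero hδ0 hδ0)]
  · rw [map_div₀, div_mul_div_comm, mul_comm u, hΘu, mul_comm δ, hΘδ, div_one]

/-! ## §2 The hyperbolic (D3) unit satisfies `ρz = κ·z` -/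

/-- **`ρz₊ = (ρμ∕μ)·z₊`** for the hyperbolic (D3) unit: `μ·h·(α − ρα) = π·z`, `ρh = −h`, `ρπ = π`, `ρ` involutive, `μ, π ≠ 0` ⇒ `ρz = (ρμ∕μ)·z` (`h(α − ρα)` and `π` are
`ρ`-fixed). [cite: Kottwitz1986BaseChangeUnits, §1 pp. 240–241] -/
theorem rho_diagUnit_eq_kappa_mul {ρ : K →+* K} (hρρ : ∀ x, ρ (ρ x) = x) {μ h α π z : K} (hρh : ρ h = -h) (hρπ : ρ π = π) (hμ0 : μ ≠ 0) (hπ0 : π ≠ 0)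
    (hzdef : μ * h * (α - ρ α) = π * z) : ρ z = ρ μ / μ * z := by
  have h1 := congrArg ρ hzdef
  rw [map_mul, map_mul, map_sub, hρρ, hρh, map_mul, hρπ] at h1
  -- `π·ρz = ρμ·h·(α − ρα)` and `π·z = μ·h·(α − ρα)`
  have h2 : π * ρ z = ρ μ * h * (α - ρ α) := by linear_combination -h1
  apply mul_left_cancel₀ hπ0
  rw [h2]
  field_simp
  linear_combination ρ μ * hzdef

/-! ## §3 The `m`-token from the norm -/

variable [Valued K ℤᵐ⁰]

/-- **`|μ| = exp(−m)` from `|μ·ρμ| = exp(−2m)`** (`ρ` isometric): the socket's token `m` (`|χ_{γ₂}(u)| = |ϖ_v^m|`, `χ(u) = (u − λ)(u − ρλ) = N_{M∕E}(u − λ)`, `|ι_w ϖ_v| = |ϖ_w|²`,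
`M∕E` unramified) is the one-field `m` of ★ p857764 ∕ p857819. [cite: Rogawski1990, §4.9 p. 55] -/
theorem v_eq_exp_neg_of_v_mul_map_eq {ρ : K →+* K} (hρv : ∀ x, Valued.v (ρ x) = Valued.v x) {μ : K} {m : ℕ}
    (h : Valued.v (μ * ρ μ) = exp (-(2 * (m : ℤ)))) : Valued.v μ = exp (-(m : ℤ)) := by
  rw [Valuation.map_mul, hρv] at h
  have hμ0 : Valued.v μ ≠ 0 := fun h0 => by rw [h0, mul_zero] at h; exact (exp_ne_zero h.symm).elim
  rw [← exp_log hμ0] at h ⊢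
  rw [← exp_add, exp_inj] at h
  rw [exp_inj]
  omega

/-! ## §4 (ED. 2) The `Θ`-fixed unramified generator `αK := α·Θα` of type RamK -/

/-- **THE RamK GENERATOR `αK` FROM THE FRAME'S `α`** (ED. 2; socket B of MAP v3, type «U-ramK»: `|α − ρα| = 1` and `|α − Θα| < 1`).  At a wild place (`|2| < 1`), with `ρ, Θ`
commuting, `Θ` involutive, both isometric, `α` integral: `αK := α·Θα` is `Θ`-fixed, integral, and `|αK − ραK| = 1` — `αK − ραK = (α − ρα)(α + ρα) + (αε − ρα·ρε)` with
`ε := Θα − α`, `|ε| < 1`, `|α + ρα| = |(α − ρα) + 2ρα| = 1`.  This is the letter `hΘα ∕ hα1 ∕ hαρ` (`αK`) of ★ p857764 ∕ p857819 ∕ p857887 ∕ p857901 ∕ p857954.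
[cite: Rogawski1990, §4.9 Lemma 4.9.3 p. 56] -/
theorem exists_thetaFixed_unramified_generator {ρ Θ : K →+* K} (hΘΘ : ∀ x, Θ (Θ x) = x) (hρΘ : ∀ x, ρ (Θ x) = Θ (ρ x))
    (hρv : ∀ x, Valued.v (ρ x) = Valued.v x) (hΘv : ∀ x, Valued.v (Θ x) = Valued.v x) (h2 : Valued.v (2 : K) < 1)
    {α : K} (hα1 : Valued.v α ≤ 1) (hαρ : Valued.v (α - ρ α) = 1) (hram : Valued.v (α - Θ α) < 1) :
    ∃ αK : K, Θ αK = αK ∧ Valued.v αK ≤ 1 ∧ Valued.v (αK - ρ αK) = 1 := by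
  refine ⟨α * Θ α, by rw [map_mul, hΘΘ, mul_comm], by rw [Valuation.map_mul, hΘv]; exact mul_le_one' hα1 hα1, ?_⟩
  have hT : Valued.v (α + ρ α) = 1 := by
    have h : α + ρ α = (α - ρ α) + 2 * ρ α := by ring
    rw [h]
    refine (Valuation.map_add_eq_of_lt_left _ ?_).trans hαρ
    rw [hαρ, Valuation.map_mul, hρv]
    calc Valued.v (2 : K) * Valued.v α ≤ Valued.v (2 : K) * 1 := by gcongr
      _ < 1 := by rw [mul_one]; exact h2
  have hmain : Valued.v ((α - ρ α) * (α + ρ α)) = 1 := by rw [Valuation.map_mul, hαρ, hT, mul_one]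
  have hid : α * Θ α - ρ (α * Θ α) = (α - ρ α) * (α + ρ α) + (α * (Θ α - α) - ρ α * ρ (Θ α - α)) := by
    rw [map_mul, hρΘ, map_sub, hρΘ]; ring
  rw [hid]
  refine (Valuation.map_add_eq_of_lt_left _ ?_).trans hmain
  rw [hmain]
  refine lt_of_le_of_lt (Valuation.map_sub _ _ _) (max_lt ?_ ?_)
  · rw [Valuation.map_mul, ← neg_sub, Valuation.map_neg]
    calc Valued.v α * Valued.v (α - Θ α) ≤ 1 * Valued.v (α - Θ α) := by gcongr
      _ < 1 := by rw [one_mul]; exact hram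
  · rw [Valuation.map_mul, hρv, hρv, ← neg_sub, Valuation.map_neg]
    calc Valued.v α * Valued.v (α - Θ α) ≤ 1 * Valued.v (α - Θ α) := by gcongr
      _ < 1 := by rw [one_mul]; exact hram

end Summit.HodgeConjecture.HodgeConjecture.Cruxes.H413.F0P3cDyRamTokenFrameGlueRamK
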